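import Literature.NumberTheory.Automorphic.UnitaryGroupSingularBracketCenter
import Literature.NumberTheory.Automorphic.UnitaryGroupIwasawaSubgroupWeightExchange
import Literature.NumberTheory.Automorphic.UnitaryGroupRationalHeisenbergSplit
import Literature.NumberTheory.Automorphic.UnitaryGroupRationalBorelCoveringWeights
import HarnessLib

/-!
# The `B_{γ₀}(F)`-cover of `B(𝔸_F)` by the Siegel set `S_B = {b : t_b ∈ S_T, y(n_b) ∈ 𝓕⁻}` at the singular Borel
# class of `U(J₃)`
(Rogawski (1990), §7.2 Prop. 7.2.1 and (7.2.3), pp. 92–93: the integral over `𝐙 B_γ(F)∖G(𝔸)` unfolded in the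
coordinates `g = n m k`, `B_γ = M N_γ`; Arthur, Duke Math. J. 45 (1978), §8; Godement, *Domaines fondamentaux des groupes
arithmétiques* (1964), §5.)

Topic `NumberTheory/Automorphic`; namespace `Literature.NumberTheory.Automorphic.UnitaryGroup`. THEOREMS ONLY (no
definition, no named fact, no instance, no notation, no `sorry`). Brick (F2) of the row (L5-iii-b2) «`∫⁻ β_{B_γ(F)}‖b_T‖ₑ < ∞`»
of the T1-qs LAW 5 road of `Cruxes/H413/Lines/F0_T1InnerFormTraceIdentity.lean` (cell `pub/hodgecm-mathlib`, crux H413;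
B-p04 (g28) census 13:05:02Z), GENERIC in the integrand — no bracket inside.

Letters: the base point `γ₀ = ι(g₀)`, `g₀ = d(a, b, a)` (★ `UnitaryGroupSingularBorelBasePoint`: `hg₀`, `hγ₀`); the
subgroup `Λ = B_{γ₀}(F) = arithmeticBorel ⊓ centralizer {γ₀}` of `G(F)`, its carriers `Λ♯ = Λ.map subtype ≤ G(𝔸_F)` and
`Λ_B = Λ♯.subgroupOf B(𝔸_F)` (★ (F1) `UnitaryGroupIwasawaSubgroupWeightExchange`); the coordinates `b = n_b · t_b`,
`t_b = torusPart b`, `n_b = b t_b⁻¹` (★ `UnitaryGroupBorelSiegelSet`), `y(n) = heisY hc n ∈ 𝔸_E⁻` (★ `UnitaryGroupHeisenberg`);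
the fundamental domain `𝓕⁻ = traceZeroFundamentalDomain F E c` of `E⁻` in `𝔸_E⁻` (★ `UnitaryGroupTraceZeroLattice`); a torus
Siegel datum `S_T ⊆ B(𝔸_F)` through its COVER clause `hcov` (★ `exists_torusSiegelSet`, verbatim). THE COVERING SET (inline):
`S_B = {b | torusPart b ∈ S_T ∧ heisY hc n_b ∈ 𝓕⁻}`.

* §1 `heisElt_zero_coe_mem_borelCentralizer` — the rational centre `n(w)`, `w ∈ E⁻`, lies in `Λ♯` (★
  `heisChart_zero_coe_mem_rationalUnipotent`, ★ `basePoint_mul_center_comm`); `torus_coe_mem_borelCentralizer` — a rational torus element lies in `Λ♯`.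
* §2 **`exists_smul_mem_siegelCover`** — every `b ∈ B(𝔸_F)` is moved into `S_B` by some `γ ∈ Λ_B` (`γ = n(w₀) · τ`: the
  rational torus element `τ` of `hcov` at `t_b`, then the lattice vector `w₀ ∈ E⁻` of ★
  `existsUnique_vadd_mem_traceZeroFundamentalDomain` at `y(τ n_b τ⁻¹)`; `torusPart` is a homomorphism killing `N(𝔸_F)`, and
  left multiplication by the centre adds to `y` without cocycle, ★ `coe_heisY_mul`); **`one_le_coveringSum_indicator_siegelCover`**
  — hence `1 ≤ Σ_{γ ∈ Λ_B} 1_{S_B}(γ b)` (the premise of ★ `lintegral_mul_le_inv_mul_setLIntegral_of_le_coveringSum_indicator`).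
* §3 `measurableSet_siegelCover` — `S_B` is Borel for Borel `S_T`.
The torus coordinates of `∫⁻_{S_B}` are in the companion leaf `UnitaryGroupSingularBorelSiegelCoverCoordinates`.

## References
* J. D. Rogawski, *Automorphic Representations of Unitary Groups in Three Variables*, Ann. of Math. Stud. 123 (1990),
  §7.2 Prop. 7.2.1, (7.2.3) (pp. 92–93) [Rogawski1990].
* J. Arthur, *A trace formula for reductive groups I*, Duke Math. J. 45 (1978), §8 [Arthur1978TraceFormulaI].
* R. Godement, *Domaines fondamentaux des groupes arithmétiques*, Sém. Bourbaki 257 (1964), §5 [Godement1964].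
-/

set_option autoImplicit false

noncomputable section

open MeasureTheory Measure NumberField IsDedekindDomain Topology
open Literature.MeasureTheory.Group
open scoped MatrixGroups NNReal ENNReal

namespace Literature.NumberTheory.Automorphic

namespace UnitaryGroup

variable {F E : Type} [Field F] [NumberField F] [Field E] [NumberField E] [Algebra F E]
  {c : E ≃ₐ[F] E}

/-! ## §1 The rational centre and the rational torus lie in `Λ♯ = B_{γ₀}(F)♯` -/

/-- **The rational centre lies in `B_{γ₀}(F)♯`**: for a lattice vector `w ∈ E⁻`, `n(w) = heisElt hc 0 w` is a rational point
(★ `heisChart_zero_coe_mem_rationalUnipotent`) of `B(𝔸_F)` commuting with the base point `γ₀ = ι(d(a,b,a))` (★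
`basePoint_mul_center_comm`). [cite: Rogawski1990, §7.2 Prop. 7.2.1 (p. 92)] -/
theorem heisElt_zero_coe_mem_borelCentralizer (hc : c * c = 1) {a b : Eˣ} {g₀ : (quasiSplit F E c 3).Rational}
    {γ₀ : (quasiSplit F E c 3).arithmeticSubgroup}
    (hg₀ : ((g₀.val : GL (Fin 3) E) : Matrix (Fin 3) (Fin 3) E) = !![(a : E), 0, 0; 0, b, 0; 0, 0, a])
    (hγ₀ : (γ₀ : (quasiSplit F E c 3).Adelic) = (quasiSplit F E c 3).toAdelic g₀) (w : rationalTraceZero F E c) :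
    (((heisElt hc 0 (w : traceZeroAdele F E c) : unipotentInBorel F E c 3) : borelAdelic F E c 3) :
        (quasiSplit F E c 3).Adelic) ∈
      (arithmeticBorel F E c 3 ⊓ Subgroup.centralizer ({γ₀} : Set (quasiSplit F E c 3).arithmeticSubgroup)).map
        (quasiSplit F E c 3).arithmeticSubgroup.subtype := by
  have hrat : (((heisElt hc 0 (w : traceZeroAdele F E c) : unipotentInBorel F E c 3) : borelAdelic F E c 3) :
      (quasiSplit F E c 3).Adelic) ∈ (quasiSplit F E c 3).arithmeticSubgroup :=
    Subgroup.mem_comap.1 (heisChart_zero_coe_mem_rationalUnipotent hc w)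
  rw [mem_map_subtype_subgroup_iff]
  refine ⟨hrat, Subgroup.mem_inf.2 ⟨(mem_arithmeticBorel_iff _).2
    ((heisElt hc 0 (w : traceZeroAdele F E c) : unipotentInBorel F E c 3) : borelAdelic F E c 3).2, ?_⟩⟩
  rw [Subgroup.mem_centralizer_iff]
  rintro g (rfl : g = γ₀)
  exact Subtype.ext (basePoint_mul_center_comm hc hg₀ hγ₀ (w : traceZeroAdele F E c))

/-- Adelic torus elements commute (local copy of ★ `mul_comm_of_mem_torusAdelic` of
`UnitaryGroupHyperbolicWeightedOrbitalUnfolding`, not imported here). [cite: Rogawski1990, §1.10] -/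
private theorem mul_comm_of_mem_torusAdelic₁₉ {N : ℕ} {g g' : (quasiSplit F E c N).Adelic} (hg : g ∈ torusAdelic F E c N)
    (hg' : g' ∈ torusAdelic F E c N) : g * g' = g' * g := by
  obtain ⟨d, hd⟩ := hg
  obtain ⟨d', hd'⟩ := hg'
  refine adelicVal_injective F E c N _ ?_
  rw [map_mul, map_mul, ← hd, ← hd', ← map_mul, ← map_mul, mul_comm]

/-- **A rational torus element lies in `B_{γ₀}(F)♯`**: it is a rational Borel element and commutes with the (diagonal) base point
`γ₀`. [cite: Rogawski1990, §7.2 Prop. 7.2.1 (p. 92)] -/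
theorem torus_coe_mem_borelCentralizer {a b : Eˣ} {g₀ : (quasiSplit F E c 3).Rational}
    {γ₀ : (quasiSplit F E c 3).arithmeticSubgroup}
    (hg₀ : ((g₀.val : GL (Fin 3) E) : Matrix (Fin 3) (Fin 3) E) = !![(a : E), 0, 0; 0, b, 0; 0, 0, a])
    (hγ₀ : (γ₀ : (quasiSplit F E c 3).Adelic) = (quasiSplit F E c 3).toAdelic g₀) {τ : borelAdelic F E c 3}
    (hτrat : (τ : (quasiSplit F E c 3).Adelic) ∈ (quasiSplit F E c 3).arithmeticSubgroup) (hτ : torusPart τ = τ) :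
    (τ : (quasiSplit F E c 3).Adelic) ∈
      (arithmeticBorel F E c 3 ⊓ Subgroup.centralizer ({γ₀} : Set (quasiSplit F E c 3).arithmeticSubgroup)).map
        (quasiSplit F E c 3).arithmeticSubgroup.subtype := by
  rw [mem_map_subtype_subgroup_iff]
  refine ⟨hτrat, Subgroup.mem_inf.2 ⟨(mem_arithmeticBorel_iff _).2 τ.2, ?_⟩⟩
  rw [Subgroup.mem_centralizer_iff]
  rintro g (rfl : g = γ₀)
  have hτT : (τ : (quasiSplit F E c 3).Adelic) ∈ torusAdelic F E c 3 := by
    rw [← hτ]; exact torusPart_mem_torusAdelic τ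
  exact Subtype.ext (mul_comm_of_mem_torusAdelic₁₉ (coe_mem_torusAdelic_of_eq_diag hg₀ hγ₀) hτT)

/-! ## §2 The cover: every `b ∈ B(𝔸_F)` is moved into `S_B` by `B_{γ₀}(F)` -/

/-- **THE `B_{γ₀}(F)`-COVER OF `B(𝔸_F)` BY `S_B = {t_b ∈ S_T, y(n_b) ∈ 𝓕⁻}`**: for every `b ∈ B(𝔸_F)` there is
`γ ∈ Λ_B = B_{γ₀}(F)♯ ∩ B(𝔸_F)` with `γ · b ∈ S_B` — move the torus coordinate into `S_T` by the rational torus element `τ`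
of the cover clause `hcov` of ★ `exists_torusSiegelSet`, then the centre coordinate of `τ n_b τ⁻¹` into `𝓕⁻` by a lattice
vector `w₀ ∈ E⁻` (★ `existsUnique_vadd_mem_traceZeroFundamentalDomain`): `γ = n(w₀) · τ` (`torusPart` is a homomorphism
killing `N(𝔸_F)`, ★ `torusPart_mul`, ★ `torusPart_eq_one_of_mem`; `y(n(w₀) n) = w₀ + y(n)`, ★ `coe_heisY_mul`). This is the
reduction behind the passage `∫_{𝐙B_γ∖𝐆} = ∫_K ∫_{M(F)∖M(𝔸)} ∫_{N_γ(F)∖N(𝔸)}` of [Prop. 7.2.1, (7.2.3)].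
[cite: Rogawski1990, §7.2 Prop. 7.2.1, (7.2.3) (pp. 92–93)] [cite: Godement1964, §5] -/
theorem exists_smul_mem_siegelCover (hc : c * c = 1) {a b : Eˣ} {g₀ : (quasiSplit F E c 3).Rational}
    {γ₀ : (quasiSplit F E c 3).arithmeticSubgroup}
    (hg₀ : ((g₀.val : GL (Fin 3) E) : Matrix (Fin 3) (Fin 3) E) = !![(a : E), 0, 0; 0, b, 0; 0, 0, a])
    (hγ₀ : (γ₀ : (quasiSplit F E c 3).Adelic) = (quasiSplit F E c 3).toAdelic g₀) {S_T : Set (borelAdelic F E c 3)}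
    (hcov : ∀ t : borelAdelic F E c 3, torusPart t = t →
      ∃ τ : borelAdelic F E c 3, (τ : (quasiSplit F E c 3).Adelic) ∈ (quasiSplit F E c 3).arithmeticSubgroup ∧
        torusPart τ = τ ∧ τ * t ∈ S_T)
    (b₀ : borelAdelic F E c 3) :
    ∃ γ : ↥(((arithmeticBorel F E c 3 ⊓ Subgroup.centralizer ({γ₀} : Set (quasiSplit F E c 3).arithmeticSubgroup)).map
        (quasiSplit F E c 3).arithmeticSubgroup.subtype).subgroupOf (borelAdelic F E c 3)),
      torusPart (γ • b₀) ∈ S_T ∧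
        heisY hc ⟨γ • b₀ * (torusPart (γ • b₀))⁻¹, mul_torusPart_inv_mem_unipotentInBorel (γ • b₀)⟩ ∈
          traceZeroFundamentalDomain F E c := by
  -- the torus step
  obtain ⟨τ, hτrat, hτ, hτS⟩ := hcov (torusPart b₀) (torusPart_torusPart b₀)
  set tτ : torusInBorel F E c 3 := ⟨τ, (mem_torusInBorel_iff_torusPart_eq τ).2 hτ⟩ with htτ
  -- the unipotent coordinate of `τ b₀` and its centre coordinate
  set n₀ : unipotentInBorel F E c 3 := ⟨b₀ * (torusPart b₀)⁻¹, mul_torusPart_inv_mem_unipotentInBorel b₀⟩ with hn₀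
  set n' : unipotentInBorel F E c 3 := isTopSemidirect_borelAdelic.conjBy tτ⁻¹ n₀ with hn'
  -- the centre step
  obtain ⟨w₀, hw₀, -⟩ := existsUnique_vadd_mem_traceZeroFundamentalDomain hc (heisY hc n')
  -- the element `γ = n(w₀) · τ`
  set γv : borelAdelic F E c 3 :=
    ((heisElt hc 0 (w₀ : traceZeroAdele F E c) : unipotentInBorel F E c 3) : borelAdelic F E c 3) * τ with hγv
  have hγmem : γv ∈ (((arithmeticBorel F E c 3 ⊓
      Subgroup.centralizer ({γ₀} : Set (quasiSplit F E c 3).arithmeticSubgroup)).map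
        (quasiSplit F E c 3).arithmeticSubgroup.subtype).subgroupOf (borelAdelic F E c 3)) := by
    rw [Subgroup.mem_subgroupOf, hγv, Subgroup.coe_mul]
    exact Subgroup.mul_mem _ (heisElt_zero_coe_mem_borelCentralizer hc hg₀ hγ₀ w₀)
      (torus_coe_mem_borelCentralizer hg₀ hγ₀ hτrat hτ)
  refine ⟨⟨γv, hγmem⟩, ?_, ?_⟩
  · -- torus coordinate: `torusPart (n(w₀) τ b₀) = τ · torusPart b₀ ∈ S_T`
    change torusPart (γv * b₀) ∈ S_T
    rw [hγv, torusPart_mul, torusPart_mul,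
      torusPart_eq_one_of_mem ((heisElt hc 0 (w₀ : traceZeroAdele F E c) : unipotentInBorel F E c 3)).2, one_mul, hτ]
    exact hτS
  · -- unipotent coordinate: `n(w₀) · (τ n₀ τ⁻¹)`, whose centre coordinate is `w₀ + y(τ n₀ τ⁻¹) ∈ 𝓕⁻`
    have hcoord : (⟨(⟨γv, hγmem⟩ : ↥(((arithmeticBorel F E c 3 ⊓
          Subgroup.centralizer ({γ₀} : Set (quasiSplit F E c 3).arithmeticSubgroup)).map
            (quasiSplit F E c 3).arithmeticSubgroup.subtype).subgroupOf (borelAdelic F E c 3))) • b₀ *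
          (torusPart ((⟨γv, hγmem⟩ : ↥(((arithmeticBorel F E c 3 ⊓
            Subgroup.centralizer ({γ₀} : Set (quasiSplit F E c 3).arithmeticSubgroup)).map
              (quasiSplit F E c 3).arithmeticSubgroup.subtype).subgroupOf (borelAdelic F E c 3))) • b₀))⁻¹,
          mul_torusPart_inv_mem_unipotentInBorel _⟩ : unipotentInBorel F E c 3) =
        heisElt hc 0 (w₀ : traceZeroAdele F E c) * n' := by
      refine Subtype.ext ?_
      change γv * b₀ * (torusPart (γv * b₀))⁻¹ =
        ((heisElt hc 0 (w₀ : traceZeroAdele F E c) : unipotentInBorel F E c 3) : borelAdelic F E c 3) *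
          (((tτ⁻¹ : torusInBorel F E c 3) : borelAdelic F E c 3)⁻¹ * (n₀ : borelAdelic F E c 3) *
            ((tτ⁻¹ : torusInBorel F E c 3) : borelAdelic F E c 3))
      rw [hγv, torusPart_mul, torusPart_mul,
        torusPart_eq_one_of_mem ((heisElt hc 0 (w₀ : traceZeroAdele F E c) : unipotentInBorel F E c 3)).2, one_mul, hτ,
        Subgroup.coe_inv, inv_inv]
      change _ * τ * b₀ * (τ * torusPart b₀)⁻¹ = _ * (τ * (b₀ * (torusPart b₀)⁻¹) * τ⁻¹)
      group
    rw [hcoord, mem_traceZeroFundamentalDomain_iff] at *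
    -- `y(n(w₀) n') = w₀ + y(n')`
    have hy : (heisY hc (heisElt hc 0 (w₀ : traceZeroAdele F E c) * n') : AdeleRing (𝓞 E) E) =
        ((w₀ : traceZeroAdele F E c) : AdeleRing (𝓞 E) E) + (heisY hc n' : AdeleRing (𝓞 E) E) := by
      rw [coe_heisY_mul hc, heisX_heisElt, heisY_heisElt, map_zero, mul_zero, zero_mul, sub_self, mul_zero, add_zero]
    have hvadd : heisY hc (heisElt hc 0 (w₀ : traceZeroAdele F E c) * n') = w₀ +ᵥ heisY hc n' :=
      Subtype.ext (by rw [hy]; rfl)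
    rw [hvadd]
    exact (mem_traceZeroFundamentalDomain_iff _).1 hw₀

/-- **Indicator form of the cover**: `1 ≤ Σ_{γ ∈ Λ_B} 1_{S_B}(γ · b)` for every `b ∈ B(𝔸_F)` — the premise `hcov` (with
`c₀ = 1`) of ★ `lintegral_mul_le_inv_mul_setLIntegral_of_le_coveringSum_indicator` for the `Λ_B`-covering weights of ★ (F1).
[cite: Rogawski1990, §7.2 (7.2.3) (p. 93)] [cite: Godement1964, §5] -/
theorem one_le_coveringSum_indicator_siegelCover (hc : c * c = 1) {a b : Eˣ} {g₀ : (quasiSplit F E c 3).Rational}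
    {γ₀ : (quasiSplit F E c 3).arithmeticSubgroup}
    (hg₀ : ((g₀.val : GL (Fin 3) E) : Matrix (Fin 3) (Fin 3) E) = !![(a : E), 0, 0; 0, b, 0; 0, 0, a])
    (hγ₀ : (γ₀ : (quasiSplit F E c 3).Adelic) = (quasiSplit F E c 3).toAdelic g₀) {S_T : Set (borelAdelic F E c 3)}
    (hcov : ∀ t : borelAdelic F E c 3, torusPart t = t →
      ∃ τ : borelAdelic F E c 3, (τ : (quasiSplit F E c 3).Adelic) ∈ (quasiSplit F E c 3).arithmeticSubgroup ∧
        torusPart τ = τ ∧ τ * t ∈ S_T)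
    (b₀ : borelAdelic F E c 3) :
    1 ≤ coveringSum ↥(((arithmeticBorel F E c 3 ⊓ Subgroup.centralizer ({γ₀} : Set (quasiSplit F E c 3).arithmeticSubgroup)).map
        (quasiSplit F E c 3).arithmeticSubgroup.subtype).subgroupOf (borelAdelic F E c 3))
      ({b : borelAdelic F E c 3 | torusPart b ∈ S_T ∧
          heisY hc ⟨b * (torusPart b)⁻¹, mul_torusPart_inv_mem_unipotentInBorel b⟩ ∈ traceZeroFundamentalDomain F E c}.indicator
        1) b₀ := by
  obtain ⟨γ, hγ⟩ := exists_smul_mem_siegelCover hc hg₀ hγ₀ hcov b₀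
  rw [coveringSum_apply]
  refine le_trans ?_ (ENNReal.le_tsum γ)
  rw [Set.indicator_of_mem (show γ • b₀ ∈ {b : borelAdelic F E c 3 | torusPart b ∈ S_T ∧
      heisY hc ⟨b * (torusPart b)⁻¹, mul_torusPart_inv_mem_unipotentInBorel b⟩ ∈ traceZeroFundamentalDomain F E c} from hγ),
    Pi.one_apply]

/-! ## §3 `S_B` is Borel -/

section Measurable

variable [MeasurableSpace (AdeleRing (𝓞 E) E)] [BorelSpace (AdeleRing (𝓞 E) E)]
  [MeasurableSpace (quasiSplit F E c 3).Adelic] [BorelSpace (quasiSplit F E c 3).Adelic]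

/-- **`S_B` is a Borel subset of `B(𝔸_F)`** for Borel `S_T` (`torusPart` is continuous, `b ↦ n_b` is measurable ★
`measurable_mul_torusPart_inv`, `heisY` is continuous, `𝓕⁻` is Borel ★ `measurableSet_traceZeroFundamentalDomain`).
[cite: Rogawski1990, §7.2 (7.2.3) (p. 93)] -/
theorem measurableSet_siegelCover (hc : c * c = 1) {S_T : Set (borelAdelic F E c 3)} (hSm : MeasurableSet S_T) :
    MeasurableSet {b : borelAdelic F E c 3 | torusPart b ∈ S_T ∧
      heisY hc ⟨b * (torusPart b)⁻¹, mul_torusPart_inv_mem_unipotentInBorel b⟩ ∈ traceZeroFundamentalDomain F E c} := by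
  refine (continuous_torusPart.measurable hSm).inter ?_
  exact ((continuous_heisY hc).measurable.comp measurable_mul_torusPart_inv) measurableSet_traceZeroFundamentalDomain

end Measurable

end UnitaryGroup

end Literature.NumberTheory.Automorphic

end
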